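import Literature.AnabelianGeometry.SemiGraphs.PSCGraphicity

/-!
# [CombGC] Proposition 1.2, sub-DAG statements: separating finite étale coverings (P12-L01)

Mochizuki, *A combinatorial version of the Grothendieck conjecture*, Tohoku Math. J. **59** (2007)
[CombGC], §1, Proposition 1.2 (Commensurable Terminality), author's manuscript p. 8, and its
PROOF, p. 9: "upon translating the group-theory of `Π_G` into the language of finite étale
coverings of `G` and possibly replacing `G` by some finite étale covering of `G` [which allows us,
in particular, to replace the words 'open in' in assertion (i) by the words 'equal to'], one sees
that to prove assertions (i), (ii), it suffices to prove, under the further assumption that `G` is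
sturdy [cf. Remark 1.1.5], that if `v₁ ≠ v₂` (respectively, `e₁ ≠ e₂`), then there exists a finite
étale `Π^unr_G`- (respectively, `Π_G`-) covering `G' → G` whose restriction to the anabelioid
`G_{v₂}` (respectively, `G_{e₂}`) is trivial [i.e., isomorphic to a disjoint union of copies of
`G_{v₂}` (respectively, `G_{e₂}`)], but whose restriction to the anabelioid `G_{v₁}` (respectively,
`G_{e₁}`) is nontrivial.  But, in light of our assumption that `G` is sturdy, one verifies immediately
that by gluing together appropriate finite étale coverings of the anabelioids `G_v`, `G_e`, one may
construct a finite étale covering `G' → G` with the desired properties."  (And: "assertion (ii)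
follows formally from assertion (i) [cf. the derivation of [SemiAnbd] Corollary 2.7, (i), from
[SemiAnbd] Proposition 2.6]".)

Sub-DAG `plan/L3/SUBDAG-CombGC-Prop12.md` of the abc-iut cell (writer: wave-4 seat
abc-iut-w4-d081; ratified by abc-iut-L3-lead ruling γ3-3, 2026-08-26T00:15:41Z) cuts the printed
proof into ONE origin-level statement — this file, row P12-L01 — and two PROVABLE group-theoretic
reductions (rows P12-L02: Prop. 1.2 (i) ⇐ L01, P12-L03: Prop. 1.2 (ii) ⇐ L01, prover seat
abc-iut-w5-d183, proof-only companions of this file).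

## How the existence statement is typed (LEVEL-WISE over one `PSCDatum`)

"Replacing `G` by some finite étale covering" is rendered WITHOUT constructing the covering as a
new datum: a finite étale `Π_G`-covering `G_V → G` is an open normal subgroup `V ⊴ Π_G`; its
vertices over `v` are the double cosets `V \ Π_G / Π_v` (`PSCFundamentalGroup.lean`: "the cusps of
`G_H` lying over the cusp `c` are the `H`-orbits in `Π/Π_c`, i.e. the double cosets `H \ Π / Π_c`;
likewise for nodes and vertices"), the vertex `V γ Π_v` having decomposition group `γ Π_v γ⁻¹ ∩ V`
(determined up to `V`-conjugacy); a finite étale GALOIS covering `G'' → G_V` is an open subgroup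
`U ≤ V` normal in `V`; its restriction to the anabelioid `(G_V)_{v'}` of the vertex
`v' = V γ Π_v` is TRIVIAL iff `γ Π_v γ⁻¹ ∩ V ≤ U` (for `U ⊴ V` this does not depend on the
representative), NONTRIVIAL iff `¬ (γ Π_v γ⁻¹ ∩ V ≤ U)` ("Galois" is no loss: replace a covering by
its Galois closure over `G_V`, which is trivial resp. nontrivial over a vertex iff the covering is).
Two vertices `(v₁, V γ₁ Π_{v₁})`, `(v₂, V γ₂ Π_{v₂})` of `G_V` are DISTINCT iff `v₁ ≠ v₂` or the
double cosets differ.  "[cf. Remark 1.1.5]" (a sturdy characteristic sub-covering exists inside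
every open subgroup) is rendered by letting the statement descend to SOME smaller level `V' ≤ V`
before separating: print's separating covering is asserted only over sturdy coverings, and the
reductions P12-L02/L03 only ever need it at arbitrarily small levels.  (At the level `V = Π_G`
itself the separating covering may fail to exist — e.g. a genus-`0` vertex all of whose branches are
nodes towards `v₂` admits no finite étale covering trivial over `G_{v₂}` and nontrivial over it —
which is exactly why print passes to a covering first.)  For the `Π^unr` clauses (the "sturdy"
halves of Prop. 1.2 (i), (ii), about the images `B_i` of `A_i` in `Π^unr_G`, recorded in the tree as
`A_i ⊔ Ker(Π_G ↠ Π^unr_G)`), the vertices of the relevant covering of `Π^unr_G` are the double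
cosets `V \ Π_G / (Π_v · Ker)` and "trivial over `v₂'`" reads `(γ₂ Π_{v₂} γ₂⁻¹ · Ker) ∩ V ≤ U`.

These are FACT-policy statements (the printed argument is the gluing of finite étale coverings of
the anabelioids `G_v`, `G_e` of a pointed stable curve — the geometric origin, absent from the
tree); they are NOT asserted here, and over an origin predicate `Ω` they are bundled as
`SeparatingCoveringsHolds Ω` exactly like the other printed statements of `PSCGraphicity.lean`.
The reductions P12-L02/L03 use, besides L01, only that `Π_G` is profinite (open normal subgroups
form a basis of neighbourhoods of `1`; instance-level `[CompactSpace Π] [TotallyDisconnectedSpace Π]`,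
Def. 1.1 (ii): "the maximal pro-Σ quotient of the profinite fundamental group").  No statement of
the paper is strengthened; typed ≠ proved; nothing here takes a side on [IUTchIII] Cor. 3.12.
-/

namespace Literature.AnabelianGeometry.SemiGraphs

namespace PSCDatum

open scoped Pointwise

universe u

variable {P : Type u} [Group P] [TopologicalSpace P]

/-! ### P12-L01: separating coverings, verticial and edge-like (`Π_G`-coverings) -/

/-- **[CombGC] Prop. 1.2, proof p. 9 — separating coverings, VERTICIAL case** (row P12-L01-V):
for every finite étale Galois covering `G_V → G` (open normal `V ⊴ Π_G`) there is a finite étale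
Galois covering `G_{V'} → G` below it (`V' ≤ V`; print: a sturdy one, "[cf. Remark 1.1.5]") such
that for any two DISTINCT vertices `v₁' = (v₁, V'γ₁Π_{v₁})`, `v₂' = (v₂, V'γ₂Π_{v₂})` of `G_{V'}`
"there exists a finite étale covering `G'' → G_{V'}` [an open `U ≤ V'`, normal in `V'`] whose
restriction to the anabelioid `(G_{V'})_{v₂'}` is trivial [`γ₂Π_{v₂}γ₂⁻¹ ∩ V' ≤ U`], but whose
restriction to `(G_{V'})_{v₁'}` is nontrivial [`¬ γ₁Π_{v₁}γ₁⁻¹ ∩ V' ≤ U`]".  Origin-level (gluing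
of coverings of the anabelioids `G_v`, `G_e`); named `Prop`, not asserted.
[cite: MochizukiCombGC2007, Prop 1.2 proof p.9] -/
def VerticialSeparatingCoverings (G : PSCDatum P) : Prop :=
  ∀ V : Subgroup P, V.Normal → IsOpen (V : Set P) →
    ∃ V' : Subgroup P, V'.Normal ∧ IsOpen (V' : Set P) ∧ V' ≤ V ∧
      ∀ (v₁ v₂ : G.graph.V) (γ₁ γ₂ : ConjAct P),
        (v₁ ≠ v₂ ∨
          DoubleCoset.doubleCoset (ConjAct.ofConjAct γ₁) (V' : Set P) (G.vertGp v₁ : Set P) ≠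
            DoubleCoset.doubleCoset (ConjAct.ofConjAct γ₂) (V' : Set P) (G.vertGp v₂ : Set P)) →
        ∃ U : Subgroup P, IsOpen (U : Set P) ∧ U ≤ V' ∧ (U.subgroupOf V').Normal ∧
          (γ₂ • G.vertGp v₂) ⊓ V' ≤ U ∧ ¬ ((γ₁ • G.vertGp v₁) ⊓ V' ≤ U)

/-- **[CombGC] Prop. 1.2, proof p. 9 — separating coverings, EDGE-LIKE case** (row P12-L01-E;
the "resp'd" case of print: "respectively, `Π_G`-covering … whose restriction to `G_{e₂}` is
trivial, but whose restriction to `G_{e₁}` is nontrivial"), for edges = nodes ⊔ cusps (`edgeGp`)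
and distinct level-`V'` edges `(e₁, V'γ₁Π_{e₁}) ≠ (e₂, V'γ₂Π_{e₂})`.  Origin-level; not asserted.
[cite: MochizukiCombGC2007, Prop 1.2 proof p.9] -/
def EdgeLikeSeparatingCoverings (G : PSCDatum P) : Prop :=
  ∀ V : Subgroup P, V.Normal → IsOpen (V : Set P) →
    ∃ V' : Subgroup P, V'.Normal ∧ IsOpen (V' : Set P) ∧ V' ≤ V ∧
      ∀ (e₁ e₂ : G.graph.N ⊕ G.graph.C) (γ₁ γ₂ : ConjAct P),
        (e₁ ≠ e₂ ∨
          DoubleCoset.doubleCoset (ConjAct.ofConjAct γ₁) (V' : Set P) (G.edgeGp e₁ : Set P) ≠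
            DoubleCoset.doubleCoset (ConjAct.ofConjAct γ₂) (V' : Set P) (G.edgeGp e₂ : Set P)) →
        ∃ U : Subgroup P, IsOpen (U : Set P) ∧ U ≤ V' ∧ (U.subgroupOf V').Normal ∧
          (γ₂ • G.edgeGp e₂) ⊓ V' ≤ U ∧ ¬ ((γ₁ • G.edgeGp e₁) ⊓ V' ≤ U)

/-! ### P12-L01, unramified-verticial case (`Π^unr_G`-coverings, `G` sturdy) -/

section Unr

variable [IsTopologicalGroup P]

/-- **[CombGC] Prop. 1.2, proof p. 9 — separating coverings, UNRAMIFIED VERTICIAL case** (row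
P12-L01-U; the non-resp'd case of print "under the further assumption that `G` is sturdy … there
exists a finite étale `Π^unr_G`-covering `G' → G` whose restriction to `G_{v₂}` is trivial, but
whose restriction to `G_{v₁}` is nontrivial", read in `Π^unr_G = Π_G / Ker`, `Ker = unrKer`):
the vertices of the covering of `Π^unr_G` at level `V` over `v` are the double cosets
`V \ Π_G / (Π_v · Ker)`; for distinct such vertices there is an open `U ≤ V'`, normal in `V'`,
containing `(γ₂Π_{v₂}γ₂⁻¹ · Ker) ∩ V'` ("trivial over `v₂'`, unramified") but not
`γ₁Π_{v₁}γ₁⁻¹ ∩ V'` ("nontrivial over `v₁'`").  Origin-level; not asserted.  (Sturdiness is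
essential: a genus-`0` vertex has trivial image in `Π^unr`, cf. Def. 1.1 (ii) / Rmk. 1.1.5.)
[cite: MochizukiCombGC2007, Prop 1.2 proof p.9] -/
def UnrVerticialSeparatingCoverings (G : PSCDatum P) : Prop :=
  G.IsSturdy → ∀ V : Subgroup P, V.Normal → IsOpen (V : Set P) →
    ∃ V' : Subgroup P, V'.Normal ∧ IsOpen (V' : Set P) ∧ V' ≤ V ∧
      ∀ (v₁ v₂ : G.graph.V) (γ₁ γ₂ : ConjAct P),
        (v₁ ≠ v₂ ∨
          DoubleCoset.doubleCoset (ConjAct.ofConjAct γ₁) (V' : Set P)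
              ((G.vertGp v₁ ⊔ G.unrKer : Subgroup P) : Set P) ≠
            DoubleCoset.doubleCoset (ConjAct.ofConjAct γ₂) (V' : Set P)
              ((G.vertGp v₂ ⊔ G.unrKer : Subgroup P) : Set P)) →
        ∃ U : Subgroup P, IsOpen (U : Set P) ∧ U ≤ V' ∧ (U.subgroupOf V').Normal ∧
          (γ₂ • G.vertGp v₂ ⊔ G.unrKer) ⊓ V' ≤ U ∧ ¬ ((γ₁ • G.vertGp v₁) ⊓ V' ≤ U)

/-- **[CombGC] Prop. 1.2, proof p. 9 — the separating-coverings step, all three cases** (row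
P12-L01 of `SUBDAG-CombGC-Prop12.md`): the single origin-level input from which Prop. 1.2 (i) and
(ii) follow by group theory (rows P12-L02, P12-L03).  Named `Prop`; not asserted.
[cite: MochizukiCombGC2007, Prop 1.2 proof p.9] -/
def SeparatingCoverings (G : PSCDatum P) : Prop :=
  G.VerticialSeparatingCoverings ∧ G.EdgeLikeSeparatingCoverings ∧ G.UnrVerticialSeparatingCoverings

/-- **[CombGC] Prop. 1.2, proof p. 9, the separating-coverings step as printed**, for every `G`
"of pro-Σ PSC-type" — i.e. over the origin predicate `Ω` of `PSCGraphicity.lean` (the same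
blackbox parameter over which `OpenInterDeterminesComponentHolds Ω` and
`CommensurableTerminalityHolds Ω`, the printed Prop. 1.2 (i)/(ii), are stated; rows P12-L02/L03
derive those two from this one).  Not asserted. [cite: MochizukiCombGC2007, Prop 1.2 proof p.9] -/
def SeparatingCoveringsHolds (Ω : PSCOrigin.{u}) : Prop :=
  ∀ ⦃Q : Type u⦄ [Group Q] [TopologicalSpace Q] [IsTopologicalGroup Q] (G : PSCDatum Q),
    Ω.IsOfPSCType G → G.SeparatingCoverings

end Unr

end PSCDatum

end Literature.AnabelianGeometry.SemiGraphs
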